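import Literature.AlgebraicGeometry.Crystalline.BlochEsnaultKerzLifting
import Literature.AlgebraicGeometry.Motives.ProjBaseChangeAny
import Literature.AlgebraicGeometry.Motives.GoodReductionSpecialFibreProofs
import Literature.AlgebraicGeometry.Motives.Sweep1
import HarnessLib

/-!
# Closed subschemes of `ℙᴺ` cut out by forms: construction over a ring and base change
# (helper for `AnchorsAtGenericHodgeLocusPoints`, stmt-HodgeConjecture-13944)

Route `PadicSemiregularLift` of `HodgeConjecture`, informal support item P2b
`AnchorsAtGenericHodgeLocusPoints`, Fermat half (B2): the anchor is the Fermat scheme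
`𝒳 = Xⁿₘ ⊂ ℙⁿ⁺¹` over `W(𝔽̄_p)`, whose special fibre is `Xⁿₘ ⊗ 𝔽̄_p` and whose generic fibre,
base-changed along `ι : K = W(𝔽̄_p)[1/p] → ℂ`, is the complex Fermat variety. The tree's carriers
for these clauses are: `Crystalline.projectiveSpaceOver N O` (`ℙᴺ_O` over a RING `O`),
`Crystalline.IsFermatLift`, `WittScheme.specialFibre/genericFibre` (both `Motives.baseChangeHom`
along a ring homomorphism) and `Motives.IsHypersurfaceCutOutBy` / `IsFermatVariety` (over a field).
This file supplies, sorry-free and for an ARBITRARY commutative base ring, the two scheme-theoretic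
facts that connect them:

* `exists_closedImmersion_range_eq_zeroLocus` — every zero locus `V₊(S) ⊆ ℙᴺ_O` underlies an
  `O`-scheme with a closed `O`-immersion into `projectiveSpaceOver N O` onto `V₊(S)` (reduced
  induced structure; Hartshorne II Example 3.2.6 — ring-base version of the tree's
  `Motives.completeIntersection` / `SmoothHypersurface.hypersurface`);
* `exists_closedImmersion_baseChangeHom_range_eq` — **base change of a cut-out**: if
  `ι : X ⟶ ℙᴺ_O` is a closed `O`-immersion with image `V₊(S)`, then for every ring homomorphism
  `φ : O → L` the base change `X ×_O L = (baseChangeHom φ).obj X` carries a closed `L`-immersion into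
  `ℙᴺ_L` with image `V₊(φ S)` (the cartesian square `ℙᴺ_L = ℙᴺ_O ×_O L` of Liu, Prop. 3.1.9 /
  Görtz–Wedhorn (13.9), `ProjBaseChangeRing.isPullback_projMap'`, pasted with the fibre square of
  `X`; image = preimage of `V₊(S)`, Mathlib `Scheme.Pullback.range_snd`);
* consequences for a FIELD `L`: the base change of an `O`-scheme smooth of relative dimension `n`
  is smooth of relative dimension `n`, hence reduced (Stacks 056T), so a smooth cut-out by one
  form `F` base-changes to a scheme CUT OUT BY `φ F` in the tree's sense
  (`isHypersurfaceCutOutBy_baseChangeHom`), and properness base-changes (`isProper_baseChangeHom_hom`).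

References: R. Hartshorne, *Algebraic Geometry* (1977), II Example 3.2.6, II Ex. 3.11 [Hartshorne1977];
Q. Liu, *Algebraic Geometry and Arithmetic Curves* (2002), Prop. 3.1.9, Ex. 3.1.10 [Liu2002];
The Stacks project, Tag 056T [StacksProject].
-/

-- the summit-side namespace `Summit.HodgeConjecture.HodgeConjecture.…` (summit = sub-problem, D-0017)
-- repeats a component by design; the linter would flag every declaration.
set_option linter.dupNamespace false

noncomputable section

open CategoryTheory CategoryTheory.Limits AlgebraicGeometry TopologicalSpace
open Literature.AlgebraicGeometry.Motives Literature.AlgebraicGeometry.Crystalline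

universe u

namespace Summit.HodgeConjecture.HodgeConjecture.Theorems.AnchorsAtGenericHodgeLocusPoints

-- No `attribute [local instance] MvPolynomial.gradedAlgebra`: the grading of `O[x₀, …, x_N]` by
-- total degree is supplied inline (`letI`), exactly as in the carriers `Crystalline.IsFermatLift`,
-- `Motives.IsHypersurfaceCutOutBy` whose statements these lemmas serve.

/-! ### Zero loci in `ℙᴺ_O` over a ring underlie closed `O`-subschemes -/

section Ring

variable {O : Type u} [CommRing O] {N : ℕ}

/-- **Every zero locus `V₊(S) ⊆ ℙᴺ_O` underlies a closed `O`-subscheme.** For a commutative ring `O`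
and a set `S ⊆ O[x₀, …, x_N]`, the closed subset `V₊(S)` of `ℙᴺ_O = Proj O[x₀, …, x_N]` with its
reduced induced closed-subscheme structure (Mathlib: the `subscheme` of the vanishing ideal sheaf
of the closed set) is an `O`-scheme `X` with a closed `O`-immersion `ι : X ⟶ projectiveSpaceOver N O`
whose image is `V₊(S)`. [cite: Hartshorne1977, II Example 3.2.6] -/
theorem exists_closedImmersion_range_eq_zeroLocus (S : Set (MvPolynomial (Fin (N + 1)) O)) :
    letI := MvPolynomial.gradedAlgebra (σ := Fin (N + 1)) (R := O)
    ∃ (X : SchemeOver O) (ι : X ⟶ projectiveSpaceOver N O), IsClosedImmersion ι.left ∧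
      Set.range ι.left.base =
        ProjectiveSpectrum.zeroLocus (MvPolynomial.homogeneousSubmodule (Fin (N + 1)) O) S := by
  letI := MvPolynomial.gradedAlgebra (σ := Fin (N + 1)) (R := O)
  let Z : Closeds (Proj (MvPolynomial.homogeneousSubmodule (Fin (N + 1)) O)) :=
    ⟨ProjectiveSpectrum.zeroLocus _ S, ProjectiveSpectrum.isClosed_zeroLocus _ S⟩
  let I := Scheme.IdealSheafData.vanishingIdeal Z
  refine ⟨Over.mk (I.subschemeι ≫ (projectiveSpaceOver N O).hom), Over.homMk I.subschemeι rfl,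
    inferInstanceAs (IsClosedImmersion I.subschemeι), ?_⟩
  change Set.range I.subschemeι = _
  rw [Scheme.IdealSheafData.range_subschemeι, Scheme.IdealSheafData.coe_support_vanishingIdeal]
  rfl

end Ring

/-! ### Base change of a cut-out along a ring homomorphism -/

section BaseChange

variable {O L : Type u} [CommRing O] [CommRing L] (φ : O →+* L) {N : ℕ}

/-- The structure morphism of `projectiveSpaceOver N O` is the tree's `ProjBaseChangeRing.projToSpec`
(`rfl`). [folklore] -/
theorem projectiveSpaceOver_hom :
    (projectiveSpaceOver N O).hom = ProjBaseChangeRing.projToSpec (Fin (N + 1)) O :=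
  rfl

/-- **Base change of a cut-out.** Let `ι : X ⟶ ℙᴺ_O` be a closed `O`-immersion whose image is the
zero locus `V₊(S)` of a set `S` of polynomials, and `φ : O → L` a ring homomorphism. Then the base
change `X ×_O L` (`(baseChangeHom φ).obj X`) admits a closed `L`-immersion into `ℙᴺ_L` whose image is
`V₊(φ S)`: the morphism to `ℙᴺ_L = ℙᴺ_O ×_{Spec O} Spec L` (Liu, Prop. 3.1.9,
`ProjBaseChangeRing.isPullback_projMap'`) with components `X ×_O L → X ↪ ℙᴺ_O` and the structure
map is the base change of `ι` along `ℙᴺ_L → ℙᴺ_O`, hence a closed immersion, and its image is the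
preimage of `V₊(S)` (Mathlib `Scheme.Pullback.range_snd`), i.e. `V₊(φ S)`.
[cite: Liu2002, Prop. 3.1.9 and Ex. 3.1.10] -/
theorem exists_closedImmersion_baseChangeHom_range_eq (X : SchemeOver O)
    (ι : X ⟶ projectiveSpaceOver N O) [IsClosedImmersion ι.left]
    (S : Set (MvPolynomial (Fin (N + 1)) O))
    (hS : letI := MvPolynomial.gradedAlgebra (σ := Fin (N + 1)) (R := O)
      Set.range ι.left.base =
        ProjectiveSpectrum.zeroLocus (MvPolynomial.homogeneousSubmodule (Fin (N + 1)) O) S) :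
    letI := MvPolynomial.gradedAlgebra (σ := Fin (N + 1)) (R := L)
    ∃ ι' : (baseChangeHom φ).obj X ⟶ projectiveSpaceOver N L, IsClosedImmersion ι'.left ∧
      Set.range ι'.left.base =
        ProjectiveSpectrum.zeroLocus (MvPolynomial.homogeneousSubmodule (Fin (N + 1)) L)
          (MvPolynomial.map φ '' S) := by
  letI := MvPolynomial.gradedAlgebra (σ := Fin (N + 1)) (R := O)
  letI := MvPolynomial.gradedAlgebra (σ := Fin (N + 1)) (R := L)
  letI : Algebra O L := φ.toAlgebra
  let pr : (projectiveSpaceOver N L).left ⟶ (projectiveSpaceOver N O).left :=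
    Proj.map (ProjBaseChangeRing.mapGraded O L (Fin (N + 1)))
      (ProjBaseChangeRing.irrelevant_le_map O L (Fin (N + 1)))
  let g : Spec (CommRingCat.of L) ⟶ Spec (CommRingCat.of O) := Spec.map (CommRingCat.ofHom φ)
  -- the cartesian square `ℙᴺ_L = ℙᴺ_O ×_O L` (`algebraMap O L = φ` by `rfl`)
  have hP : IsPullback pr (ProjBaseChangeRing.projToSpec (Fin (N + 1)) L)
      (ProjBaseChangeRing.projToSpec (Fin (N + 1)) O) g :=
    ProjBaseChangeRing.isPullback_projMap' O L (n := N)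
  -- the fibre square of `X` over `Spec φ`, with `X → Spec O` written as `X ↪ ℙᴺ_O → Spec O`
  have hX : IsPullback (pullback.fst X.hom g) (pullback.snd X.hom g)
      (ι.left ≫ ProjBaseChangeRing.projToSpec (Fin (N + 1)) O) g := by
    rw [← projectiveSpaceOver_hom, Over.w ι]
    exact IsPullback.of_hasPullback X.hom g
  -- the embedding of the base change `X ×_O L = pullback X.hom g` into `ℙᴺ_L`
  let e : pullback X.hom g ⟶ (projectiveSpaceOver N L).left :=
    hP.lift (pullback.fst X.hom g ≫ ι.left) (pullback.snd X.hom g)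
      (by rw [Category.assoc]; exact hX.w)
  have he₁ : e ≫ pr = pullback.fst X.hom g ≫ ι.left := hP.lift_fst _ _ _
  have he₂ : e ≫ ProjBaseChangeRing.projToSpec (Fin (N + 1)) L = pullback.snd X.hom g :=
    hP.lift_snd _ _ _
  -- it is the base change of `ι` along `ℙᴺ_L → ℙᴺ_O` …
  have hsq : IsPullback (pullback.fst X.hom g) e ι.left pr := by
    refine IsPullback.of_bot ?_ he₁.symm hP
    rw [he₂]
    exact hX
  -- … hence a closed immersion
  have hci : IsClosedImmersion e :=
    MorphismProperty.of_isPullback (P := @IsClosedImmersion) hsq inferInstance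
  refine ⟨Over.homMk e he₂, hci, ?_⟩
  change Set.range e.base = _
  -- its image is the image of the second projection of the pullback, i.e. the preimage of `V₊(S)`
  have hsurj : Function.Surjective hsq.isoPullback.hom.base :=
    hsq.isoPullback.hom.homeomorph.surjective
  have hr : Set.range e.base = Set.range (pullback.snd ι.left pr).base := by
    rw [← hsq.isoPullback_hom_snd, Scheme.Hom.comp_base, TopCat.coe_comp, hsurj.range_comp]
  have hr' : Set.range (pullback.snd ι.left pr).base = pr.base ⁻¹' Set.range ι.left.base :=
    Scheme.Pullback.range_snd ι.left pr
  rw [hr, hr', hS]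
  ext q
  change S ⊆ ((pr.base q).asHomogeneousIdeal : Set (MvPolynomial (Fin (N + 1)) O)) ↔
    MvPolynomial.map φ '' S ⊆ (q.asHomogeneousIdeal : Set (MvPolynomial (Fin (N + 1)) L))
  rw [Set.image_subset_iff]
  exact ⟨fun h G hG => h hG, fun h G hG => h hG⟩

/-- **Base change of a hypersurface cut-out** (one form): with `S = {F}` the image of the base
change is `V₊(φ F)`. [cite: Liu2002, Prop. 3.1.9 and Ex. 3.1.10] -/
theorem exists_closedImmersion_baseChangeHom_range_eq_singleton (X : SchemeOver O)
    (ι : X ⟶ projectiveSpaceOver N O) [IsClosedImmersion ι.left] (F : MvPolynomial (Fin (N + 1)) O)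
    (hF : letI := MvPolynomial.gradedAlgebra (σ := Fin (N + 1)) (R := O)
      Set.range ι.left.base =
        ProjectiveSpectrum.zeroLocus (MvPolynomial.homogeneousSubmodule (Fin (N + 1)) O) {F}) :
    letI := MvPolynomial.gradedAlgebra (σ := Fin (N + 1)) (R := L)
    ∃ ι' : (baseChangeHom φ).obj X ⟶ projectiveSpaceOver N L, IsClosedImmersion ι'.left ∧
      Set.range ι'.left.base =
        ProjectiveSpectrum.zeroLocus (MvPolynomial.homogeneousSubmodule (Fin (N + 1)) L)
          {MvPolynomial.map φ F} := by
  simpa only [Set.image_singleton] using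
    exists_closedImmersion_baseChangeHom_range_eq φ X ι {F} hF

/-- Base change preserves projectivity over the base ring: if `X` is projective over the ring `O`
then `X ×_O L` is projective over `L` (closed immersions are stable under base change).
[cite: Hartshorne1977, II Ex. 3.11 (a)] -/
theorem isProjectiveOverRing_baseChangeHom {X : SchemeOver O} (hX : IsProjectiveOverRing X) :
    IsProjectiveOverRing ((baseChangeHom φ).obj X) := by
  obtain ⟨N, ι, hι⟩ := hX
  letI := MvPolynomial.gradedAlgebra (σ := Fin (N + 1)) (R := O)
  -- the image of a closed immersion is closed, hence the zero locus of its vanishing ideal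
  have hclosed : IsClosed (Set.range ι.left.base) := ι.left.isClosedEmbedding.isClosed_range
  obtain ⟨ι', hι', -⟩ := exists_closedImmersion_baseChangeHom_range_eq φ X ι
    (ProjectiveSpectrum.vanishingIdeal (Set.range ι.left.base) : Set (MvPolynomial (Fin (N + 1)) O))
    (by rw [ProjectiveSpectrum.zeroLocus_vanishingIdeal_eq_closure]; exact hclosed.closure_eq.symm)
  exact ⟨N, ι', hι'⟩

/-- **Smoothness base-changes**: if `X → Spec O` is smooth of relative dimension `n`, so is
`X ×_O L → Spec L` (Mathlib: `SmoothOfRelativeDimension` is stable under base change).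
[cite: Hartshorne1977, III Prop. 10.1 (b)] -/
theorem smoothOfRelativeDimension_baseChangeHom_hom {n : ℕ} {X : SchemeOver O}
    (hX : SmoothOfRelativeDimension n X.hom) :
    SmoothOfRelativeDimension n ((baseChangeHom φ).obj X).hom :=
  haveI := smoothOfRelativeDimension_isStableUnderBaseChange (n := n)
  MorphismProperty.pullback_snd (P := @SmoothOfRelativeDimension n) _ _ hX

/-- **Properness base-changes**: if `X → Spec O` is proper, so is `X ×_O L → Spec L`.
[cite: Hartshorne1977, II Cor. 4.8 (c)] -/
theorem isProper_baseChangeHom_hom {X : SchemeOver O} (hX : IsProper X.hom) :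
    IsProper ((baseChangeHom φ).obj X).hom :=
  MorphismProperty.pullback_snd (P := @IsProper) _ _ hX

end BaseChange

/-! ### Base change to a field: reducedness and the cut-out predicate -/

section Field

variable {O L : Type u} [CommRing O] [Field L] (φ : O →+* L) {N : ℕ}

/-- Over a FIELD `L`, the base change of an `O`-scheme smooth of relative dimension `n` is reduced
(it is smooth over `L`; Stacks 056T, the tree's `isReduced_of_smoothOfRelativeDimension`).
[cite: StacksProject, Tag 056T] -/
theorem isReduced_baseChangeHom_left {n : ℕ} {X : SchemeOver O}
    (hX : SmoothOfRelativeDimension n X.hom) : IsReduced ((baseChangeHom φ).obj X).left :=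
  @isReduced_of_smoothOfRelativeDimension L _ _ ((baseChangeHom φ).obj X).hom n
    (smoothOfRelativeDimension_baseChangeHom_hom φ hX)

/-- **A smooth cut-out base-changes to a cut-out.** If `X → Spec O` is smooth of relative dimension
`n` and `ι : X ⟶ ℙᴺ_O` is a closed `O`-immersion with image `V₊(F)`, then for every ring
homomorphism `φ : O → L` to a field, `X ×_O L` is the reduced closed subscheme of `ℙᴺ_L` cut out by
`φ F` (`Motives.IsHypersurfaceCutOutBy N (φ F)`): reduced because smooth over `L`, embedded by the
base change of `ι`. [cite: Hartshorne1977, II Example 3.2.6] [cite: Liu2002, Prop. 3.1.9 and Ex. 3.1.10] -/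
theorem isHypersurfaceCutOutBy_baseChangeHom {n : ℕ} (X : SchemeOver O)
    (hX : SmoothOfRelativeDimension n X.hom) (ι : X ⟶ projectiveSpaceOver N O)
    [IsClosedImmersion ι.left] (F : MvPolynomial (Fin (N + 1)) O)
    (hF : letI := MvPolynomial.gradedAlgebra (σ := Fin (N + 1)) (R := O)
      Set.range ι.left.base =
        ProjectiveSpectrum.zeroLocus (MvPolynomial.homogeneousSubmodule (Fin (N + 1)) O) {F}) :
    IsHypersurfaceCutOutBy N (MvPolynomial.map φ F) ((baseChangeHom φ).obj X) := by
  obtain ⟨ι', hι', hrange⟩ := exists_closedImmersion_baseChangeHom_range_eq_singleton φ X ι F hF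
  exact ⟨isReduced_baseChangeHom_left φ hX, ι', hι', hrange⟩

end Field

end Summit.HodgeConjecture.HodgeConjecture.Theorems.AnchorsAtGenericHodgeLocusPoints

end
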